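import Literature.AlgebraicGeometry.Resolution.AffineBlowupAlgebra
import Summits.ResolutionOfSingularities.ResolutionOfSingularities.Theorems.SectionAscentFibrewiseClosedPointsCertificateRegularLocQuot
import Literature.AlgebraicGeometry.Resolution.RegularLocalRingsQuotient
import Literature.AlgebraicGeometry.Resolution.RegularLocalRingsFlatDescent
import Literature.RingTheory.IntegralClosure.KrullIntersection
import Mathlib.RingTheory.MvPolynomial.Localization
import Mathlib.RingTheory.Ideal.Height
import Mathlib.RingTheory.Polynomial.IsIntegral
import Mathlib.RingTheory.Polynomial.Basic
import Mathlib.Algebra.MvPolynomial.Equiv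
import Mathlib.RingTheory.Localization.LocalizationLocalization
import Mathlib.RingTheory.Flat.Localization
import Mathlib.RingTheory.GradedAlgebra.HomogeneousLocalization
import HarnessLib

/-!
# Cartier ascent at a certified point: the chart-level criterion via Nagata's ring `R(t)`

Support file for crux stmt-ResolutionOfSingularities-15960
(`SectionAscent.FibrewiseClosedPoints`, line `registered`, stub `stub_certificateRegular`).

Let `C₀ = (A[It])_{(at)}` be a chart ring of `Bl_I(Spec A)` (`A` a Noetherian domain,
`0 ≠ a ∈ I`), `𝔮₀ ⊆ C₀` a prime with normal local ring `R = (C₀)_{𝔮₀}` of dimension `≥ 2`, and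
`c₁, …, c_s ∈ 𝔮₀` (`c_j = g_j/a^m`) such that every prime `𝔭 ⊊ 𝔮₀` misses some `c_j`. Suppose
a ring `E` receives `D = C₀[t₁, …, t_s]` by a map `θ₀` with: every element of `E` is a fraction
`θ₀(d)/θ₀(σ)` (`0 ≠ σ ∈ K[t]`); the kernel of `θ₀` is described by
`θ₀(d) = 0 ⇒ a^N d σ = ℓ₀ d''` (`ℓ₀ = a^m ℓ'`, `ℓ' = Σ c_j t_j`); `θ₀(ℓ₀) = 0`, `θ₀(a)` is a
non-zero-divisor; and every local ring of `E` is regular. Then `R` is regular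
(`stub_certificateRegularChart`). Printed proof: Nagata's `T = R(t) = R[t]_{𝔪R[t]}` is a
Noetherian normal local domain, flat and local over `R`; in `T` the ideal `(ℓ')` is `a`-saturated
(Matsumura 11.5: `T = ⋂_{ht P = 1} T_P`, and a height-one prime containing `a` and `ℓ'` would be
`𝔭T` for a prime `𝔭 ⊊ 𝔮₀` containing all `c_j`), so `(ker θ₀)T = ℓ'T` and `E_𝔮 ≅ T/ℓ'T` for a
prime `𝔮` of `E` (local rings of a localization followed by a surjection, hypothesis `hLQ` =
`stub_certificateRegularLocQuot`); hence `T/ℓ'T` is regular, so is `T` (EGA IV 0.17.1.7, tree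
`IsRegularLocalRing.of_quotient_span_singleton`), and `R` by flat descent (Matsumura 23.7, tree
`IsRegularLocalRing.of_flat_of_isLocalHom`). No definitions are introduced.

References: M. Nagata, *Local Rings* (the ring `R(x)`); C. Huneke, I. Swanson, *Integral Closure
of Ideals, Rings, and Modules*, Lemma 8.4.2; H. Matsumura, *Commutative Ring Theory*, Thm. 11.5,
Thm. 23.7; EGA IV, 0.17.1.7.
-/

-- single-problem summit: the doubled namespace component is forced
set_option linter.dupNamespace false
-- Mathlib is built with this depth; the default (1) makes instance search on the chart rings
-- `(A[It])_{(at)}` (subalgebra-valued gradings) fail or diverge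
set_option maxSynthPendingDepth 3

noncomputable section

namespace Summit.ResolutionOfSingularities.ResolutionOfSingularities.Theorems.SectionAscent.CertificateRegular

open MvPolynomial IsLocalRing Literature.AlgebraicGeometry.Resolution
open scoped BigOperators

/-! ## Polynomial bookkeeping -/

section Poly

variable {R : Type*} [CommRing R] {σ : Type*}

/-- The coefficient of `t_j` in `Σ c_i t_i` is `c_j`. [folklore] -/
theorem coeff_single_sum_C_mul_X {n : ℕ} (c : Fin n → R) (j : Fin n) :
    MvPolynomial.coeff (Finsupp.single j 1) (∑ i : Fin n, C (c i) * X i) = c j := by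
  classical
  rw [MvPolynomial.coeff_sum]
  simp_rw [MvPolynomial.coeff_C_mul, MvPolynomial.coeff_X]
  rw [Finset.sum_eq_single j]
  · simp
  · intro i _ hij
    rw [if_neg, mul_zero]
    exact fun h => hij (Finsupp.single_left_injective one_ne_zero h)
  · intro h
    exact absurd (Finset.mem_univ j) h

end Poly

/-! ## The chart ring `(A[It])_{(at)}` -/

section ChartRing

variable {A : Type*} [CommRing A] {I : Ideal A} (a : A) (ha : a ∈ I)

/-- For a domain `A` and `a ≠ 0`, `A → (A[It])_{(at)}` is injective. [folklore] -/
theorem reesChartBase_injective' [IsDomain A] (ha0 : a ≠ 0) : Function.Injective (reesChartBase a ha) := by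
  have hinj : Function.Injective (algebraMap A (Localization.Away a)) :=
    IsLocalization.injective (M := Submonoid.powers a) (Localization.Away a)
      (powers_le_nonZeroDivisors_of_noZeroDivisors ha0)
  rw [← reesChart_comp_reesChartBase a ha, RingHom.coe_comp] at hinj
  exact Function.Injective.of_comp hinj

/-- `(A[It])_{(at)}` is Noetherian for Noetherian `A`. [folklore] -/
theorem isNoetherianRing_away' [IsNoetherianRing A] :
    IsNoetherianRing (HomogeneousLocalization.Away (reesGrading I) (reesT a ha)) := by
  haveI : IsNoetherianRing (reesGrading I 0) :=
    isNoetherianRing_of_ringEquiv A (reesGrading.zeroEquiv I)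
  haveI : Algebra.FiniteType (reesGrading I 0)
      (HomogeneousLocalization.Away (reesGrading I) (reesT a ha)) :=
    HomogeneousLocalization.Away.finiteType (reesT a ha) 1 (reesT_mem a ha)
  exact Algebra.FiniteType.isNoetherianRing (reesGrading I 0)
    (HomogeneousLocalization.Away (reesGrading I) (reesT a ha))

/-- `(A[It])_{(at)}` is a domain for a domain `A` and `a ≠ 0`. [folklore] -/
theorem isDomain_away' [IsDomain A] (ha0 : a ≠ 0) :
    IsDomain (HomogeneousLocalization.Away (reesGrading I) (reesT a ha)) := by
  haveI : IsDomain (Localization.Away a) :=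
    IsLocalization.isDomain_localization (powers_le_nonZeroDivisors_of_noZeroDivisors ha0)
  exact Function.Injective.isDomain (reesChart a ha) (reesChart_injective a ha)

end ChartRing

attribute [local instance] MvPolynomial.algebraMvPolynomial
attribute [local instance] isPrime_map_C

/-! Notation (file-local, unhygienic: it refers to the variables `I a ha s 𝔮₀ R₀` of the statements
below): `C₀ = (A[It])_{(at)}`, `D♭ = C₀[t]`, `𝔔♭ = 𝔮₀ D♭`, `D♯ = R₀[t]`, `𝔔♯ = 𝔪_{R₀} D♯`, where
`R₀` is (any localization presenting) `(C₀)_{𝔮₀}`; `T` below is any localization presenting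
Nagata's `R₀(t) = (D♯)_{𝔔♯}`. -/

set_option hygiene false in
local notation "C₀" => HomogeneousLocalization.Away (reesGrading I) (reesT a ha)
set_option hygiene false in
local notation "D♭" => MvPolynomial (Fin s) C₀
set_option hygiene false in
local notation "𝔔♭" => Ideal.map (MvPolynomial.C : C₀ →+* D♭) (PrimeSpectrum.asIdeal 𝔮₀)
set_option hygiene false in
local notation "D♯" => MvPolynomial (Fin s) R₀
set_option hygiene false in
local notation "𝔔♯" => Ideal.map (MvPolynomial.C : R₀ →+* D♯) (IsLocalRing.maximalIdeal R₀)
set_option hygiene false in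
local notation "ι₀" => (algebraMap C₀ R₀ : C₀ →+* R₀)

section Nagata

variable {A : Type} [CommRing A] {I : Ideal A} (a : A) (ha : a ∈ I) (s : ℕ)
  (𝔮₀ : PrimeSpectrum (HomogeneousLocalization.Away (reesGrading I) (reesT a ha)))
  (R₀ : Type) [CommRing R₀] [IsLocalRing R₀]
  [Algebra (HomogeneousLocalization.Away (reesGrading I) (reesT a ha)) R₀]
  [IsLocalization.AtPrime R₀ 𝔮₀.asIdeal]
  (T : Type) [CommRing T] [Algebra (MvPolynomial (Fin s) R₀) T]
  [IsLocalization.AtPrime T (Ideal.map (MvPolynomial.C : R₀ →+* MvPolynomial (Fin s) R₀)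
    (IsLocalRing.maximalIdeal R₀))]

/-- `𝔪_{R₀} D♯ ∩ D♭ = 𝔮₀ D♭`. [folklore] -/
theorem comap_map_maximalIdeal :
    Ideal.comap (MvPolynomial.map (σ := Fin s) (algebraMap C₀ R₀)) 𝔔♯ = 𝔔♭ := by
  ext f
  rw [Ideal.mem_comap, MvPolynomial.mem_map_C_iff, MvPolynomial.mem_map_C_iff]
  refine forall_congr' fun mono => ?_
  rw [MvPolynomial.coeff_map, IsLocalization.AtPrime.to_map_mem_maximal_iff R₀ 𝔮₀.asIdeal]

/-- **`T = R₀(t)` is the localization of `D♭ = C₀[t]` at `𝔮₀ D♭`** (localize in two steps), for the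
composite structure map `D♭ → D♯ → T`. [folklore] -/
theorem isLocalization_nagata :
    letI : Algebra D♭ T := ((algebraMap D♯ T).comp (MvPolynomial.map (algebraMap C₀ R₀))).toAlgebra
    IsLocalization.AtPrime T 𝔔♭ := by
  letI : Algebra D♭ T := ((algebraMap D♯ T).comp (MvPolynomial.map (algebraMap C₀ R₀))).toAlgebra
  haveI : IsScalarTower D♭ D♯ T := IsScalarTower.of_algebraMap_eq fun x => rfl
  have h := IsLocalization.isLocalization_isLocalization_atPrime_isLocalization
      ((PrimeSpectrum.asIdeal 𝔮₀).primeCompl.map (C : C₀ →+* D♭)) T (𝔔♯ : Ideal D♯)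
  convert h using 2
  exact (comap_map_maximalIdeal a ha s 𝔮₀ R₀).symm

variable [Algebra R₀ T] [IsScalarTower R₀ (MvPolynomial (Fin s) R₀) T]

include s in
/-- `R₀ → T` is a local homomorphism. [folklore] -/
theorem isLocalHom_nagata : IsLocalHom (algebraMap R₀ T) := by
  haveI := IsLocalization.AtPrime.isLocalRing T (𝔔♯ : Ideal D♯)
  refine ⟨fun x hx => ?_⟩
  by_contra hxu
  have hxm : algebraMap R₀ T x ∈ maximalIdeal T := by
    rw [IsScalarTower.algebraMap_apply R₀ D♯ T,
      IsLocalization.AtPrime.to_map_mem_maximal_iff T (𝔔♯ : Ideal D♯)]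
    exact Ideal.mem_map_of_mem C hxu
  exact hxm hx

include s in
/-- `T` is flat over `R₀`. [folklore] -/
theorem flat_nagata : Module.Flat R₀ T := by
  haveI : Module.Flat D♯ T := IsLocalization.flat T (𝔔♯ : Ideal D♯).primeCompl
  exact Module.Flat.trans R₀ D♯ T

/-- Non-zero scalars of `K[t]` lie outside `𝔮₀ D♭`. [folklore] -/
theorem map_scalar_notMem {K : Type} [Field K] [Algebra K A] {σ : MvPolynomial (Fin s) K} (hσ : σ ≠ 0) :
    MvPolynomial.map ((reesChartBase a ha).comp (algebraMap K A)) σ ∉ 𝔔♭ := by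
  intro hmem
  obtain ⟨mono, hmono⟩ := MvPolynomial.ne_zero_iff.mp hσ
  rw [MvPolynomial.mem_map_C_iff] at hmem
  have h1 := hmem mono
  rw [MvPolynomial.coeff_map] at h1
  have hu : IsUnit (((reesChartBase a ha).comp (algebraMap K A)) (MvPolynomial.coeff mono σ)) :=
    (IsUnit.mk0 _ hmono).map _
  exact 𝔮₀.isPrime.ne_top (Ideal.eq_top_of_isUnit_mem _ h1 hu)

omit [Algebra R₀ T] [IsScalarTower R₀ (MvPolynomial (Fin s) R₀) T] in
/-- **Saturation in `R₀(t)`** (Matsumura 11.5 applied in `T`; see the module docstring).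
[cite: Matsumura1987, Thm. 11.5] -/
theorem saturation_nagata [IsDomain C₀] [IsDomain R₀] [IsDomain T] [IsNoetherianRing T] [IsIntegrallyClosed T]
    (hdim : (1 : ℕ∞) < (maximalIdeal R₀).height) (c : Fin s → C₀)
    (hcb : ∀ 𝔭 : PrimeSpectrum C₀, 𝔭 ≤ 𝔮₀ → 𝔭 ≠ 𝔮₀ → ∃ j, c j ∉ 𝔭.asIdeal)
    (x₀ : C₀) (hx₀ : x₀ ≠ 0)
    (hℓ : algebraMap D♯ T (∑ j : Fin s, C (ι₀ (c j)) * X j) ≠ 0)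
    (y : T) (N : ℕ)
    (hy : algebraMap D♯ T (C (ι₀ x₀)) ^ N * y ∈
      Ideal.span {algebraMap D♯ T (∑ j : Fin s, C (ι₀ (c j)) * X j)}) :
    y ∈ Ideal.span {algebraMap D♯ T (∑ j : Fin s, C (ι₀ (c j)) * X j)} := by
  refine Literature.RingTheory.IntegralClosure.mem_span_singleton_of_forall_height_eq_one hℓ
    fun P hP hP1 => ?_
  by_cases hℓP : algebraMap D♯ T (∑ j : Fin s, C (ι₀ (c j)) * X j) ∈ P
  swap
  · exact ⟨_, hℓP, Ideal.mul_mem_right _ _ (Ideal.mem_span_singleton_self _)⟩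
  by_cases haP : algebraMap D♯ T (C (ι₀ x₀)) ∈ P
  swap
  · exact ⟨_, fun h => haP (hP.mem_of_pow_mem N h), hy⟩
  exfalso
  haveI := hP
  -- `P' = P ∩ D♯` has height one and is extended from `q' = P' ∩ R₀`
  have hP' : (P.under D♯).height = 1 := by
    rw [IsLocalization.height_under (𝔔♯ : Ideal D♯).primeCompl P]; exact hP1
  have ha'q : (C (ι₀ x₀) : D♯) ∈ P.under D♯ := Ideal.mem_comap.mpr haP
  have ha'0 : ι₀ x₀ ≠ 0 := fun h =>
    hx₀ (IsLocalization.injective R₀ (Ideal.primeCompl_le_nonZeroDivisors 𝔮₀.asIdeal)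
      (h.trans (map_zero _).symm))
  have hqP : ((P.under D♯).comap (C : R₀ →+* D♯)).map C = P.under D♯ := by
    refine eq_of_le_of_height_eq_one (fun h0 => ha'0 ?_) (Ideal.map_le_iff_le_comap.mpr le_rfl) hP'
    have h1 : C (ι₀ x₀) ∈ ((P.under D♯).comap (C : R₀ →+* D♯)).map (C : R₀ →+* D♯) :=
      Ideal.mem_map_of_mem C (Ideal.mem_comap.mpr ha'q)
    rw [h0, Ideal.mem_bot, MvPolynomial.C_eq_zero] at h1
    exact h1
  -- all `c_j ∈ q'`
  have hℓ'P : (∑ j : Fin s, C (ι₀ (c j)) * X j : D♯) ∈ P.under D♯ :=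
    Ideal.mem_comap.mpr hℓP
  rw [← hqP, MvPolynomial.mem_map_C_iff] at hℓ'P
  have hcq : ∀ j, ι₀ (c j) ∈ (P.under D♯).comap (C : R₀ →+* D♯) := fun j => by
    have h := hℓ'P (Finsupp.single j 1)
    rwa [coeff_single_sum_C_mul_X] at h
  -- `q' ≠ 𝔪`: the height of `𝔪 D♯` is at least two
  have hqm : (P.under D♯).comap (C : R₀ →+* D♯) ≠ maximalIdeal R₀ := by
    intro h
    have h1 : P.under D♯ = 𝔔♯ := by rw [← hqP, h]
    have h2 : (1 : ℕ∞) < (𝔔♯ : Ideal D♯).height := lt_of_lt_of_le hdim (height_le_height_map_C _)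
    rw [← h1, hP'] at h2
    exact lt_irrefl _ h2
  -- pull back to `C₀`: a prime strictly below `𝔮₀` containing every `c_j`
  let 𝔭 : PrimeSpectrum C₀ :=
    ⟨((P.under D♯).comap (C : R₀ →+* D♯)).comap (algebraMap C₀ R₀), Ideal.comap_isPrime _ _⟩
  have hq'le : (P.under D♯).comap (C : R₀ →+* D♯) ≤ maximalIdeal R₀ :=
    IsLocalRing.le_maximalIdeal (Ideal.IsPrime.ne_top inferInstance)
  have h𝔭le : 𝔭 ≤ 𝔮₀ := by
    intro x hx
    exact (IsLocalization.AtPrime.to_map_mem_maximal_iff R₀ 𝔮₀.asIdeal x).mp (hq'le hx)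
  have h𝔭ne : 𝔭 ≠ 𝔮₀ := by
    intro h
    apply hqm (le_antisymm hq'le ?_)
    rw [← IsLocalization.AtPrime.map_eq_maximalIdeal 𝔮₀.asIdeal R₀, Ideal.map_le_iff_le_comap]
    intro x hx
    have : x ∈ 𝔭.asIdeal := by rw [h]; exact hx
    exact this
  obtain ⟨j, hj⟩ := hcb 𝔭 h𝔭le h𝔭ne
  exact hj (hcq j)

end Nagata

/-- **Cartier ascent at a certified point, chart form** (`stub_certificateRegularChart`; see the
module docstring for the notation and the printed proof via Nagata's ring `R(t)`; `R₀` is any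
localization presenting the local ring `(C₀)_{𝔮₀}` and `T` any localization presenting
`R₀(t) = R₀[t]_{𝔪R₀[t]}`).
[cite: Matsumura1987, Thm. 23.7; EGAIV4, 0.17.1.7; HunekeSwanson2006, Lemma 8.4.2] -/
theorem stub_certificateRegularChart (K A : Type) [Field K] [CommRing A] [IsDomain A] [IsNoetherianRing A] [Algebra K A] (I : Ideal A) (a : A) (ha : a ∈ I) (ha0 : a ≠ 0) (s m : ℕ) (g : Fin s → A) (𝔮₀ : PrimeSpectrum (HomogeneousLocalization.Away (Literature.AlgebraicGeometry.Resolution.reesGrading I) (Literature.AlgebraicGeometry.Resolution.reesT a ha))) (R₀ : Type) [CommRing R₀] [IsLocalRing R₀] [Algebra (HomogeneousLocalization.Away (Literature.AlgebraicGeometry.Resolution.reesGrading I) (Literature.AlgebraicGeometry.Resolution.reesT a ha)) R₀] [IsLocalization.AtPrime R₀ 𝔮₀.asIdeal] (hnorm : IsIntegrallyClosed R₀) (hdim : 1 < ringKrullDim R₀) (T : Type) [CommRing T] [Algebra (MvPolynomial (Fin s) R₀) T] [IsLocalization.AtPrime T (Ideal.map (MvPolynomial.C : R₀ →+* MvPolynomial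 (Fin s) R₀) (IsLocalRing.maximalIdeal R₀))] [Algebra R₀ T] [IsScalarTower R₀ (MvPolynomial (Fin s) R₀) T] (c : Fin s → HomogeneousLocalization.Away (Literature.AlgebraicGeometry.Resolution.reesGrading I) (Literature.AlgebraicGeometry.Resolution.reesT a ha)) (hc : ∀ j, Literature.AlgebraicGeometry.Resolution.reesChartBase a ha (a ^ m) * c j = Literature.AlgebraicGeometry.Resolution.reesChartBase a ha (g j)) (hca : ∀ j, c j ∈ 𝔮₀.asIdeal) (hcb : ∀ 𝔭 : PrimeSpectrum (HomogeneousLocalization.Away (Literature.AlgebraicGeometry.Resolution.reesGrading I) (Literature.AlgebraicGeometry.Resolution.reesT a ha)), 𝔭 ≤ 𝔮₀ → 𝔭 ≠ 𝔮₀ → ∃ j, c j ∉ 𝔭.asIdeal) (E : Type) [CommRing E] (θ₀ : MvPolynomial (Fin s) (HomogeneousLocalization.Away (Literature.AlgebraicGeometry.Resolution.reesGrading I) (Literature.AlgebraicGeometry.Resolution.reesT a ha)) →+* E) (hgen : ∀ e : E, ∃ σ : MvPolynomial (Fin s) K, σ ≠ 0 ∧ ∃ d, e * θ₀ (MvPolynomial.map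 ((Literature.AlgebraicGeometry.Resolution.reesChartBase a ha).comp (algebraMap K A)) σ) = θ₀ d) (hkerθ : ∀ d, θ₀ d = 0 → ∃ (N : ℕ) (σ : MvPolynomial (Fin s) K), σ ≠ 0 ∧ ∃ d'', MvPolynomial.C (Literature.AlgebraicGeometry.Resolution.reesChartBase a ha a) ^ N * d * MvPolynomial.map ((Literature.AlgebraicGeometry.Resolution.reesChartBase a ha).comp (algebraMap K A)) σ = (∑ j : Fin s, MvPolynomial.C (Literature.AlgebraicGeometry.Resolution.reesChartBase a ha (g j)) * MvPolynomial.X j) * d'') (hθℓ : θ₀ (∑ j : Fin s, MvPolynomial.C (Literature.AlgebraicGeometry.Resolution.reesChartBase a ha (g j)) * MvPolynomial.X j) = 0) (hθa : θ₀ (MvPolynomial.C (Literature.AlgebraicGeometry.Resolution.reesChartBase a ha a)) ∈ nonZeroDivisors E) (hreg : ∀ 𝔮 : PrimeSpectrum E, IsRegularLocalRing (Localization.AtPrime 𝔮.asIdeal)) (hLQ : ∀ (S : Submonoid (MvPolynomial (Fin s) (HomogeneousLocalization.Away (Literature.AlgebraicGeometry.Resolution.reesGrading I) (Literature.AlgebraicGeometry.Resolution.reesT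 a ha)))) (𝔔 : Ideal (MvPolynomial (Fin s) (HomogeneousLocalization.Away (Literature.AlgebraicGeometry.Resolution.reesGrading I) (Literature.AlgebraicGeometry.Resolution.reesT a ha)))) [𝔔.IsPrime], (∀ e : E, ∃ x ∈ S, ∃ d, e * θ₀ x = θ₀ d) → (∀ x ∈ S, x ∉ 𝔔) → (∀ d, θ₀ d = 0 → d ∈ 𝔔) → ∀ (T' : Type) [CommRing T'] [Algebra (MvPolynomial (Fin s) (HomogeneousLocalization.Away (Literature.AlgebraicGeometry.Resolution.reesGrading I) (Literature.AlgebraicGeometry.Resolution.reesT a ha))) T'] [IsLocalization.AtPrime T' 𝔔], ∃ 𝔮 : PrimeSpectrum E, 𝔮.asIdeal.comap θ₀ = 𝔔 ∧ Nonempty (Localization.AtPrime 𝔮.asIdeal ≃+* T' ⧸ (RingHom.ker θ₀).map (algebraMap (MvPolynomial (Fin s) (HomogeneousLocalization.Away (Literature.AlgebraicGeometry.Resolution.reesGrading I) (Literature.AlgebraicGeometry.Resolution.reesT a ha))) T'))) : IsRegularLocalRing R₀ := by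
  haveI hC₀noeth : IsNoetherianRing C₀ := isNoetherianRing_away' a ha
  haveI hC₀dom : IsDomain C₀ := isDomain_away' a ha ha0
  have ha₀ : reesChartBase a ha a ≠ 0 := fun h =>
    ha0 (reesChartBase_injective' a ha ha0 (h.trans (map_zero _).symm))
  haveI : IsNoetherianRing R₀ := IsLocalization.isNoetherianRing 𝔮₀.asIdeal.primeCompl R₀ hC₀noeth
  haveI : IsDomain R₀ := IsLocalization.isDomain_of_atPrime R₀ 𝔮₀.asIdeal
  haveI : IsIntegrallyClosed R₀ := hnorm
  haveI : IsLocalRing T := IsLocalization.AtPrime.isLocalRing T (𝔔♯ : Ideal D♯)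
  haveI : IsNoetherianRing T := IsLocalization.isNoetherianRing (𝔔♯ : Ideal D♯).primeCompl T inferInstance
  haveI : IsDomain T := IsLocalization.isDomain_of_atPrime T (𝔔♯ : Ideal D♯)
  haveI : IsIntegrallyClosed T := by
    haveI : IsIntegrallyClosed D♯ := isIntegrallyClosed_mvPolynomial_fin R₀ s
    exact isIntegrallyClosed_of_isLocalization T (𝔔♯ : Ideal D♯).primeCompl
      (Ideal.primeCompl_le_nonZeroDivisors _)
  -- the composite structure map `φ : D♭ → D♯ → T`, a localization of `D♭` at `𝔮₀ D♭`
  letI algDT : Algebra D♭ T := ((algebraMap D♯ T).comp (MvPolynomial.map (algebraMap C₀ R₀))).toAlgebra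
  have hT : IsLocalization.AtPrime T 𝔔♭ := isLocalization_nagata a ha s 𝔮₀ R₀ T
  have halg : ∀ f : D♭, algebraMap D♭ T f = algebraMap D♯ T (MvPolynomial.map (algebraMap C₀ R₀) f) :=
    fun f => rfl
  -- `dim R₀ ≥ 2`, so `𝔮₀ ≠ 0`, some `c_j ≠ 0`, and `ℓ' = Σ c_j t_j ≠ 0`
  have hdimR : (1 : ℕ∞) < (maximalIdeal R₀).height := by
    have h := IsLocalRing.maximalIdeal_height_eq_ringKrullDim (R := R₀)
    rw [← h] at hdim
    exact_mod_cast hdim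
  have h𝔮₀ne : (⊥ : PrimeSpectrum C₀) ≠ 𝔮₀ := by
    intro h0
    have hh : 𝔮₀.asIdeal.height = 0 := by
      rw [← h0, PrimeSpectrum.asIdeal_bot]; exact Ideal.height_bot
    have h := IsLocalization.AtPrime.ringKrullDim_eq_height 𝔮₀.asIdeal R₀
    rw [hh] at h
    rw [h] at hdim
    exact absurd hdim (not_lt.mpr (by exact_mod_cast zero_le_one))
  have hℓ'0 : (∑ j : Fin s, C (c j) * X j : D♭) ≠ 0 := by
    obtain ⟨j, hj⟩ := hcb ⊥ bot_le h𝔮₀ne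
    intro h0
    apply hj
    have e := coeff_single_sum_C_mul_X c j
    rw [h0, MvPolynomial.coeff_zero] at e
    rw [PrimeSpectrum.asIdeal_bot, Ideal.mem_bot]
    exact e.symm
  have hinjDT : Function.Injective (algebraMap D♭ T) :=
    IsLocalization.injective T (Ideal.primeCompl_le_nonZeroDivisors 𝔔♭)
  have hmapℓ' : MvPolynomial.map (algebraMap C₀ R₀) (∑ j : Fin s, C (c j) * X j) =
      ∑ j : Fin s, C (ι₀ (c j)) * X j := by
    rw [map_sum]
    refine Finset.sum_congr rfl fun j _ => ?_
    rw [map_mul, MvPolynomial.map_C, MvPolynomial.map_X]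
  have hℓT : algebraMap D♭ T (∑ j : Fin s, C (c j) * X j) =
      algebraMap D♯ T (∑ j : Fin s, C (ι₀ (c j)) * X j) := by
    rw [halg, hmapℓ']
  have hℓT0 : algebraMap D♯ T (∑ j : Fin s, C (ι₀ (c j)) * X j) ≠ 0 := fun h =>
    hℓ'0 (hinjDT ((hℓT.trans h).trans (map_zero _).symm))
  -- the elements `ℓ' = Σ c_j t_j`, `ℓ₀ = a^m ℓ'`
  have hℓ₀ : (∑ j : Fin s, C (reesChartBase a ha (g j)) * X j : D♭) =
      C (reesChartBase a ha a) ^ m * ∑ j : Fin s, C (c j) * X j := by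
    rw [Finset.mul_sum]
    refine Finset.sum_congr rfl fun j _ => ?_
    have hpow : (C (reesChartBase a ha (a ^ m)) : D♭) = C (reesChartBase a ha a) ^ m :=
      map_pow ((MvPolynomial.C : C₀ →+* D♭).comp (reesChartBase a ha)) a m
    rw [← mul_assoc, ← hpow, ← map_mul, hc j]
  have hθℓ' : θ₀ (∑ j : Fin s, C (c j) * X j) = 0 := by
    rw [hℓ₀, map_mul, map_pow] at hθℓ
    exact (mem_nonZeroDivisors_iff_left.mp (pow_mem hθa m)) _ hθℓ
  have hℓ'𝔔 : (∑ j : Fin s, C (c j) * X j : D♭) ∈ 𝔔♭ :=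
    Ideal.sum_mem _ fun j _ => Ideal.mul_mem_right _ _ (Ideal.mem_map_of_mem C (hca j))
  have hℓTmax : algebraMap D♭ T (∑ j : Fin s, C (c j) * X j) ∈ maximalIdeal T :=
    (IsLocalization.AtPrime.to_map_mem_maximal_iff T 𝔔♭ _).mpr hℓ'𝔔
  have haT : algebraMap D♭ T (C (reesChartBase a ha a)) =
      algebraMap D♯ T (C (ι₀ (reesChartBase a ha a))) := by
    rw [halg, MvPolynomial.map_C]
  -- `θ₀ d = 0 ⇒ d ∈ ℓ' T` (saturation), whence `(ker θ₀) T = ℓ' T` and `ker θ₀ ⊆ 𝔮₀ D♭`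
  have hsat : ∀ d, θ₀ d = 0 →
      algebraMap D♭ T d ∈ Ideal.span {algebraMap D♭ T (∑ j : Fin s, C (c j) * X j)} := by
    intro d hd
    obtain ⟨N, σ, hσ, d'', hrel⟩ := hkerθ d hd
    rw [hℓ₀] at hrel
    have hu : IsUnit (algebraMap D♭ T (MvPolynomial.map ((reesChartBase a ha).comp (algebraMap K A)) σ)) :=
      IsLocalization.map_units T (⟨_, map_scalar_notMem a ha s 𝔮₀ hσ⟩ : (𝔔♭ : Ideal D♭).primeCompl)
    have e := congrArg (algebraMap D♭ T) hrel
    simp only [map_mul, map_pow] at e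
    rw [hℓT]
    refine saturation_nagata a ha s 𝔮₀ R₀ T hdimR c hcb _ ha₀ hℓT0 _ N ?_
    rw [← haT, ← hℓT, Ideal.mem_span_singleton]
    refine (IsUnit.dvd_mul_right hu).mp ⟨algebraMap D♭ T (C (reesChartBase a ha a)) ^ m *
      algebraMap D♭ T d'', ?_⟩
    rw [e]
    ring
  have hmapker : (RingHom.ker θ₀).map (algebraMap D♭ T) =
      Ideal.span {algebraMap D♭ T (∑ j : Fin s, C (c j) * X j)} := by
    apply le_antisymm
    · rw [Ideal.map_le_iff_le_comap]
      intro d hd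
      exact hsat d hd
    · rw [Ideal.span_le, Set.singleton_subset_iff]
      exact Ideal.mem_map_of_mem _ hθℓ'
  have hker𝔔 : ∀ d, θ₀ d = 0 → d ∈ 𝔔♭ := by
    intro d hd
    have h2 : Ideal.span {algebraMap D♭ T (∑ j : Fin s, C (c j) * X j)} ≤ maximalIdeal T := by
      rw [Ideal.span_le, Set.singleton_subset_iff]; exact hℓTmax
    exact (IsLocalization.AtPrime.to_map_mem_maximal_iff T 𝔔♭ d).mp (h2 (hsat d hd))
  -- the local ring of `E` at `𝔮 = 𝔔♭E` is `T/ℓ'T`, hence `T/ℓ'T` is regular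
  obtain ⟨𝔮, -, ⟨e𝔮⟩⟩ := hLQ ((nonZeroDivisors (MvPolynomial (Fin s) K)).map
      (MvPolynomial.map ((reesChartBase a ha).comp (algebraMap K A)))) 𝔔♭
    (fun e => by
      obtain ⟨σ, hσ, d, h⟩ := hgen e
      exact ⟨_, ⟨σ, mem_nonZeroDivisors_of_ne_zero hσ, rfl⟩, d, h⟩)
    (by
      rintro _ ⟨σ, hσ, rfl⟩
      exact map_scalar_notMem a ha s 𝔮₀ (nonZeroDivisors.ne_zero hσ))
    hker𝔔 T
  haveI : IsRegularLocalRing (T ⧸ Ideal.span {algebraMap D♭ T (∑ j : Fin s, C (c j) * X j)}) :=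
    haveI := hreg 𝔮
    IsRegularLocalRing.of_ringEquiv (e𝔮.trans (Ideal.quotEquivOfEq hmapker))
  -- Cartier ascent `T/ℓ'T` regular ⇒ `T` regular, then flat descent `T ⇒ R₀`
  have hreg' : IsSMulRegular T (algebraMap D♭ T (∑ j : Fin s, C (c j) * X j)) := by
    rw [hℓT]
    exact (IsRegular.of_ne_zero hℓT0).left.isSMulRegular
  haveI : IsRegularLocalRing T := IsRegularLocalRing.of_quotient_span_singleton hℓTmax hreg'
  haveI : Module.Flat R₀ T := flat_nagata s R₀ T
  haveI : IsLocalHom (algebraMap R₀ T) := isLocalHom_nagata s R₀ T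
  exact IsRegularLocalRing.of_flat_of_isLocalHom R₀ T

end Summit.ResolutionOfSingularities.ResolutionOfSingularities.Theorems.SectionAscent.CertificateRegular

end
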